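import Summits.BirchSwinnertonDyer.BirchSwinnertonDyer.Theorems.BiquadraticEisensteinDescentHeegnerTwistCouplingInSupplyLinnikCensusKOne
import Mathlib.Tactic.NormNum.LegendreSymbol
import HarnessLib

set_option linter.dupNamespace false -- `Summit.BirchSwinnertonDyer.BirchSwinnertonDyer.Theorems.…` (summit = sub)
set_option autoImplicit false

/-!
# Crux `HeegnerTwistCouplingInSupply` (stmt-BirchSwinnertonDyer-21381) — the k = 1 PATTERN-FREE CENSUS, THREE slots:
# the configurations `(p ≡ 7, r ≡ 1, (r/p) = +1)` odd and `(p ≡ 3 or 7, r ≡ 1, (r/p) = +1)` even, which own no two-slot family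

Route `BiquadraticEisensteinDescent` (cell `pub/bsd-wall`, width seat `bsd-wall-cm-bed-w3` g19; `--supports` 21381, helper).
Companion of `…LinnikCensusKOne` (two slots). Three of the sixteen k = 1 configurations own only THREE-slot pattern-free families (the
recipe wins for all EIGHT mutual patterns; kernel-checked per instance by `decide`). The assembly is the same with three slot censuses
and the size lemma `size_three` (`q₀q₁q₂ ≤ y³`, `y = ⌊⌊√Q⌋^{1/2}⌋ ≥ 256` ⇒ `√(q₀q₁q₂)·log(q₀q₁q₂) < π y² < πp`, via `log y < 4·y^{1/4}`):

* ★★ `kOne_allBut_three_of_BT` (`W = E_{pr}`) / `kOne_allBut_three_even_of_BT` (`W = E_{2pr}`), modulo Burungale–Tian ONLY;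
* ★ `cruxConclusion_E17p_allBut_of_BT` — headline instance `W = E_{17p}`, every `p ≡ 7 (mod 8)`: `(17/p) = −1` by the two-slot family
  (cells `(3,+),(5,+)`, signs `+,−`, slots `35, 13 (mod 136)`), `(17/p) = +1` by the three-slot family (cells `(1,−),(3,+),(5,−)`, signs
  `+,+,−`, slots `41, 35, 5 (mod 136)`);
* (the route-decl BODY corollaries for `E_{3p}` / `E_{10p}` and the any-`r` three-slot versions live in `…LinnikCensusKOneAnyR`.)

HONEST FRAMING: RUNG-LEVEL, per fixed `r`, density one in `p` with a polylog exceptional set; congruent two-parameter families only; the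
crux as stated (C⁺), its stubs and BSD are NOT touched; nothing is closed. THEOREMS ONLY (no `def`).
-/

namespace Summit.BirchSwinnertonDyer.BirchSwinnertonDyer.Theorems.LinnikCensus

open Finset
open Literature.NumberTheory.EllipticCurves
open Summit.BirchSwinnertonDyer.BirchSwinnertonDyer.Theorems.SymbolicMonsky

/-! ## Size for three slots -/

/-- `log y < 4 · y^{1/4}` and hence `3 log y < π √y` once `y ≥ 256` (`y^{1/4} ≥ 4 > 12/π`). [folklore] -/
theorem three_mul_log_lt_pi_mul_sqrt {y : ℝ} (hy : 256 ≤ y) : 3 * Real.log y < Real.pi * Real.sqrt y := by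
  have hy0 : 0 < y := by linarith
  set v := Real.sqrt y with hv
  set u := Real.sqrt v with hu
  have hv0 : 0 < v := Real.sqrt_pos.mpr hy0
  have hu0 : 0 < u := Real.sqrt_pos.mpr hv0
  have hvv : v * v = y := Real.mul_self_sqrt hy0.le
  have huu : u * u = v := Real.mul_self_sqrt hv0.le
  have hv16 : 16 ≤ v := by
    rw [hv, show (16 : ℝ) = Real.sqrt (16 ^ 2) by rw [Real.sqrt_sq (by norm_num)]]
    exact Real.sqrt_le_sqrt (by linarith)
  have hu4 : 4 ≤ u := by
    rw [hu, show (4 : ℝ) = Real.sqrt (4 ^ 2) by rw [Real.sqrt_sq (by norm_num)]]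
    exact Real.sqrt_le_sqrt (by linarith)
  have hlogy : Real.log y = 4 * Real.log u := by
    rw [← hvv, ← huu, Real.log_mul (by positivity) (by positivity), Real.log_mul hu0.ne' hu0.ne']; ring
  have hlogu : Real.log u ≤ u - 1 := Real.log_le_sub_one_of_pos hu0
  calc 3 * Real.log y = 12 * Real.log u := by rw [hlogy]; ring
    _ ≤ 12 * (u - 1) := by gcongr
    _ < 12 * u := by linarith
    _ ≤ Real.pi * u * u := by nlinarith [Real.pi_gt_three]
    _ = Real.pi * v := by rw [mul_assoc, huu]

/-- **Size for three slots**: `qᵢ ≤ y`, `1 ≤ qᵢ`, `256 ≤ y`, `y² < p` ⇒ `√(q₀q₁q₂)·log(q₀q₁q₂) < πp`. [folklore] -/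
theorem size_three {q0 q1 q2 y p : ℕ} (h0 : 1 ≤ q0) (h1 : 1 ≤ q1) (h2 : 1 ≤ q2) (hq0 : q0 ≤ y) (hq1 : q1 ≤ y) (hq2 : q2 ≤ y)
    (hy : 256 ≤ y) (hp : y ^ 2 < p) :
    Real.sqrt ((q0 * q1 * q2 : ℕ) : ℝ) * Real.log ((q0 * q1 * q2 : ℕ) : ℝ) < Real.pi * p := by
  have hy' : (256 : ℝ) ≤ y := by exact_mod_cast hy
  have hy0 : (0 : ℝ) < y := by linarith
  have hm1 : (1 : ℝ) ≤ ((q0 * q1 * q2 : ℕ) : ℝ) := by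
    exact_mod_cast Nat.one_le_iff_ne_zero.mpr (Nat.mul_ne_zero (Nat.mul_ne_zero (by omega) (by omega)) (by omega))
  have hmy : ((q0 * q1 * q2 : ℕ) : ℝ) ≤ (y : ℝ) ^ 3 := by
    have : q0 * q1 * q2 ≤ y ^ 3 := by
      calc q0 * q1 * q2 ≤ y * y * y := Nat.mul_le_mul (Nat.mul_le_mul hq0 hq1) hq2
        _ = y ^ 3 := by ring
    exact_mod_cast this
  have hsqrt : Real.sqrt ((q0 * q1 * q2 : ℕ) : ℝ) ≤ y * Real.sqrt y := by
    calc Real.sqrt ((q0 * q1 * q2 : ℕ) : ℝ) ≤ Real.sqrt ((y : ℝ) ^ 3) := Real.sqrt_le_sqrt hmy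
      _ = Real.sqrt ((y : ℝ) ^ 2 * y) := by ring_nf
      _ = y * Real.sqrt y := by rw [Real.sqrt_mul (by positivity), Real.sqrt_sq hy0.le]
  have hlog : Real.log ((q0 * q1 * q2 : ℕ) : ℝ) ≤ 3 * Real.log y := by
    calc Real.log ((q0 * q1 * q2 : ℕ) : ℝ) ≤ Real.log ((y : ℝ) ^ 3) := Real.log_le_log (by positivity) hmy
      _ = 3 * Real.log y := by rw [Real.log_pow]; norm_num
  have hlog0 : 0 ≤ Real.log ((q0 * q1 * q2 : ℕ) : ℝ) := Real.log_nonneg hm1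
  have hkey := three_mul_log_lt_pi_mul_sqrt hy'
  have hp' : (y : ℝ) ^ 2 < p := by exact_mod_cast hp
  have hsy : Real.sqrt y * Real.sqrt y = y := Real.mul_self_sqrt hy0.le
  calc Real.sqrt ((q0 * q1 * q2 : ℕ) : ℝ) * Real.log ((q0 * q1 * q2 : ℕ) : ℝ)
      ≤ (y * Real.sqrt y) * (3 * Real.log y) := mul_le_mul hsqrt hlog hlog0 (by positivity)
    _ < (y * Real.sqrt y) * (Real.pi * Real.sqrt y) := by
        apply mul_lt_mul_of_pos_left hkey; positivity
    _ = Real.pi * (y : ℝ) ^ 2 := by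
        calc (y * Real.sqrt y) * (Real.pi * Real.sqrt y) = Real.pi * y * (Real.sqrt y * Real.sqrt y) := by ring
          _ = Real.pi * (y : ℝ) ^ 2 := by rw [hsy]; ring
    _ < Real.pi * p := by gcongr

/-! ## The three-slot census, odd base `E_{pr}` -/

open scoped Classical in
/-- ★★ **k = 1 pattern-free census, three slots, odd base `W = E_{pr}`** (as `kOne_allBut_two_of_BT`, for a three-slot family that wins for
all eight mutual patterns; threshold `Q ≥ 2³²` so that `⌊⌊√Q⌋^{1/2}⌋ ≥ 256` for the size lemma, folded into the exceptional set below it).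
[cite: BurungaleTian2026, Thm. 1.1] [cite: Montgomery1978, p. 561] [cite: MontgomeryVaughan2007, Cor. 11.17] -/
theorem kOne_allBut_three_of_BT (hBT : burungaleTian_analyticRank_eq_zero_of_selmerCorank_eq_zero_of_hasCM)
    {pc rc : Fin 4} {rp : Bool} (c0 c1 c2 : Fin 4 × Bool) (s0 s1 s2 : Bool) (h01 : c0 ≠ c1) (h02 : c0 ≠ c2) (h12 : c1 ≠ c2)
    (hwin : ∀ b01 b02 b12 : Bool,
      (⟨[c0, c1, c2], [s0, s1, s2], [[b01, b02], [b12]]⟩ : Recipe).winsPR pc rc rp = true)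
    {r : ℕ} (hr : r.Prime) (hrm : r % 8 = clsVal rc) (k0 k1 k2 : ℕ)
    (hk0u : IsUnit ((k0 : ℕ) : ZMod (8 * r))) (hk1u : IsUnit ((k1 : ℕ) : ZMod (8 * r)))
    (hk2u : IsUnit ((k2 : ℕ) : ZMod (8 * r)))
    (hk0m : k0 % 8 = clsVal c0.1) (hk1m : k1 % 8 = clsVal c1.1) (hk2m : k2 % 8 = clsVal c2.1)
    (hk0e : ∀ q : ℕ, q.Prime → q % (8 * r) = k0 % (8 * r) → (jacobiSym (q : ℤ) r = -1 ↔ c0.2 = true))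
    (hk1e : ∀ q : ℕ, q.Prime → q % (8 * r) = k1 % (8 * r) → (jacobiSym (q : ℤ) r = -1 ↔ c1.2 = true))
    (hk2e : ∀ q : ℕ, q.Prime → q % (8 * r) = k2 % (8 * r) → (jacobiSym (q : ℤ) r = -1 ↔ c2.2 = true)) :
    ∃ C : ℝ, 0 < C ∧ ∀ Q : ℕ, 3 ≤ Q → ∃ E : Finset ℕ, (E.card : ℝ) ≤ C * Real.log Q ^ 8 ∧
      ∀ p : ℕ, p.Prime → p % 8 = clsVal pc → (jacobiSym (r : ℤ) p = -1 ↔ rp = true) →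
        Nat.sqrt Q < p → p ≤ Q → p ∉ E →
        ∃ (K : Type) (_ : Field K) (_ : NumberField K),
          IsImaginaryQuadratic K ∧ 4 < (NumberField.discr K).natAbs ∧
          SatisfiesHeegnerHypothesis ((congruentNumberCurve (p * r)).conductorNorm ℤ) K ∧
          ((congruentNumberCurve (p * r)).quadraticTwist (NumberField.discr K : ℚ)).entireLFunction 1 ≠ 0 ∧
          ¬ p ∣ NumberField.classNumber K := by
  haveI : NeZero (8 * r) := ⟨Nat.mul_ne_zero (by norm_num) hr.ne_zero⟩
  have hσ0 : (if s0 then (-1 : ℤ) else 1) = 1 ∨ (if s0 then (-1 : ℤ) else 1) = -1 := by cases s0 <;> simp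
  have hσ1 : (if s1 then (-1 : ℤ) else 1) = 1 ∨ (if s1 then (-1 : ℤ) else 1) = -1 := by cases s1 <;> simp
  have hσ2 : (if s2 then (-1 : ℤ) else 1) = 1 ∨ (if s2 then (-1 : ℤ) else 1) = -1 := by cases s2 <;> simp
  obtain ⟨C0, hC0, hcen0⟩ := slotCensus (8 * r) k0 hk0u hσ0
  obtain ⟨C1, hC1, hcen1⟩ := slotCensus (8 * r) k1 hk1u hσ1
  obtain ⟨C2, hC2, hcen2⟩ := slotCensus (8 * r) k2 hk2u hσ2
  -- threshold: `r² ≤ Q` and `256⁴ ≤ Q`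
  refine ⟨C0 + C1 + C2 + ((r : ℝ) ^ 2 + 256 ^ 4 + 1), by positivity, fun Q hQ3 => ?_⟩
  have hlog3 : 1 ≤ Real.log Q := by
    have hQ3' : (3 : ℝ) ≤ Q := by exact_mod_cast hQ3
    have he : Real.exp 1 ≤ (Q : ℝ) := le_trans (le_of_lt (lt_trans Real.exp_one_lt_d9 (by norm_num))) hQ3'
    rwa [← Real.log_le_log_iff (Real.exp_pos 1) (by linarith), Real.log_exp] at he
  have hlog8 : 1 ≤ Real.log Q ^ 8 := one_le_pow₀ hlog3
  by_cases hQr : r ^ 2 + 256 ^ 4 ≤ Q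
  · set E0 := (Finset.range (Q + 1)).filter (fun p : ℕ => p.Prime ∧ Nat.sqrt Q < p ∧
        ∀ q : ℕ, q.Prime → q % (8 * r) = k0 % (8 * r) → q ≤ Nat.sqrt (Nat.sqrt Q) →
          jacobiSym (q : ℤ) p ≠ (if s0 then (-1 : ℤ) else 1)) with hE0
    set E1 := (Finset.range (Q + 1)).filter (fun p : ℕ => p.Prime ∧ Nat.sqrt Q < p ∧
        ∀ q : ℕ, q.Prime → q % (8 * r) = k1 % (8 * r) → q ≤ Nat.sqrt (Nat.sqrt Q) →
          jacobiSym (q : ℤ) p ≠ (if s1 then (-1 : ℤ) else 1)) with hE1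
    set E2 := (Finset.range (Q + 1)).filter (fun p : ℕ => p.Prime ∧ Nat.sqrt Q < p ∧
        ∀ q : ℕ, q.Prime → q % (8 * r) = k2 % (8 * r) → q ≤ Nat.sqrt (Nat.sqrt Q) →
          jacobiSym (q : ℤ) p ≠ (if s2 then (-1 : ℤ) else 1)) with hE2
    refine ⟨E0 ∪ E1 ∪ E2, ?_, ?_⟩
    · have hu : ((E0 ∪ E1 ∪ E2).card : ℝ) ≤ (E0.card : ℝ) + E1.card + E2.card := by
        have a := Finset.card_union_le (E0 ∪ E1) E2
        have b := Finset.card_union_le E0 E1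
        exact_mod_cast a.trans (Nat.add_le_add_right b _)
      calc ((E0 ∪ E1 ∪ E2).card : ℝ) ≤ (E0.card : ℝ) + E1.card + E2.card := hu
        _ ≤ C0 * Real.log Q ^ 8 + C1 * Real.log Q ^ 8 + C2 * Real.log Q ^ 8 :=
            add_le_add (add_le_add (hcen0 Q hQ3) (hcen1 Q hQ3)) (hcen2 Q hQ3)
        _ ≤ (C0 + C1 + C2 + ((r : ℝ) ^ 2 + 256 ^ 4 + 1)) * Real.log Q ^ 8 := by nlinarith
    intro p hp hpm hrp hyp hpQ hpE
    simp only [Finset.mem_union, not_or] at hpE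
    obtain ⟨⟨hn0, hn1⟩, hn2⟩ := hpE
    obtain ⟨q0, hq0, hq0k, hq0y, hJ0⟩ := exists_slotPrime hp hyp hpQ hn0
    obtain ⟨q1, hq1, hq1k, hq1y, hJ1⟩ := exists_slotPrime hp hyp hpQ hn1
    obtain ⟨q2, hq2, hq2k, hq2y, hJ2⟩ := exists_slotPrime hp hyp hpQ hn2
    obtain ⟨hq0m, hq0r⟩ := slot_props hr hk0u hq0k hk0m
    obtain ⟨hq1m, hq1r⟩ := slot_props hr hk1u hq1k hk1m
    obtain ⟨hq2m, hq2r⟩ := slot_props hr hk2u hq2k hk2m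
    have he0 := hk0e q0 hq0 hq0k
    have he1 := hk1e q1 hq1 hq1k
    have he2 := hk2e q2 hq2 hq2k
    have hyQ : Nat.sqrt (Nat.sqrt Q) ≤ Nat.sqrt Q := Nat.sqrt_le_self _
    have hq0p : q0 ≠ p := by intro h; subst h; omega
    have hq1p : q1 ≠ p := by intro h; subst h; omega
    have hq2p : q2 ≠ p := by intro h; subst h; omega
    have hrQ : r ≤ Nat.sqrt Q := Nat.le_sqrt'.mpr (le_trans (Nat.le_add_right _ _) hQr)
    have hpr : p ≠ r := by intro h; subst h; omega
    have hd01 : q0 ≠ q1 := ne_of_cells_ne h01 hq0m hq1m he0 he1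
    have hd02 : q0 ≠ q2 := ne_of_cells_ne h02 hq0m hq2m he0 he2
    have hd12 : q1 ≠ q2 := ne_of_cells_ne h12 hq1m hq2m he1 he2
    have hysq : Nat.sqrt (Nat.sqrt Q) ^ 2 ≤ Nat.sqrt Q := Nat.sqrt_le' _
    have hy256 : 256 ≤ Nat.sqrt (Nat.sqrt Q) := by
      rw [Nat.le_sqrt', Nat.le_sqrt']
      exact le_trans (by norm_num) (le_trans (Nat.le_add_left _ _) hQr)
    have hsize := size_three hq0.one_lt.le hq1.one_lt.le hq2.one_lt.le hq0y hq1y hq2y hy256 (lt_of_le_of_lt hysq hyp)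
    exact Recipe.RealisesK1.cruxOnEpr_of_patternFree_three_of_BT hBT c0 c1 c2 s0 s1 s2 hwin hp hr hq0 hq1 hq2 hpm hrm
      hq0m hq1m hq2m hpr hq0p hq1p hq2p hq0r hq1r hq2r hd01 hd02 hd12 hrp
      (sign_iff_of_eq hJ0) (sign_iff_of_eq hJ1) (sign_iff_of_eq hJ2) he0 he1 he2 hsize
  · refine ⟨Finset.range (Q + 1), ?_, fun p _ _ _ _ hpQ hpE => absurd (Finset.mem_range.mpr (by omega)) hpE⟩
    have hQ' : Q < r ^ 2 + 256 ^ 4 := not_le.mp hQr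
    have h1 : ((Finset.range (Q + 1)).card : ℝ) ≤ (r : ℝ) ^ 2 + 256 ^ 4 + 1 := by
      rw [Finset.card_range]; exact_mod_cast (by omega : Q + 1 ≤ r ^ 2 + 256 ^ 4 + 1)
    calc ((Finset.range (Q + 1)).card : ℝ) ≤ (r : ℝ) ^ 2 + 256 ^ 4 + 1 := h1
      _ ≤ C0 + C1 + C2 + ((r : ℝ) ^ 2 + 256 ^ 4 + 1) := by linarith
      _ = (C0 + C1 + C2 + ((r : ℝ) ^ 2 + 256 ^ 4 + 1)) * 1 := (mul_one _).symm
      _ ≤ (C0 + C1 + C2 + ((r : ℝ) ^ 2 + 256 ^ 4 + 1)) * Real.log Q ^ 8 :=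
          mul_le_mul_of_nonneg_left hlog8 (by positivity)

/-! ## The three-slot census, even base `E_{2pr}` -/

open scoped Classical in
/-- ★★ **k = 1 pattern-free census, three slots, even base `W = E_{2pr}`.** [cite: BurungaleTian2026, Thm. 1.1]
[cite: Montgomery1978, p. 561] [cite: MontgomeryVaughan2007, Cor. 11.17] -/
theorem kOne_allBut_three_even_of_BT (hBT : burungaleTian_analyticRank_eq_zero_of_selmerCorank_eq_zero_of_hasCM)
    {pc rc : Fin 4} {rp : Bool} (c0 c1 c2 : Fin 4 × Bool) (s0 s1 s2 : Bool) (h01 : c0 ≠ c1) (h02 : c0 ≠ c2) (h12 : c1 ≠ c2)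
    (hwin : ∀ b01 b02 b12 : Bool,
      (⟨[c0, c1, c2], [s0, s1, s2], [[b01, b02], [b12]]⟩ : Recipe).wins2PR pc rc rp = true)
    {r : ℕ} (hr : r.Prime) (hrm : r % 8 = clsVal rc) (k0 k1 k2 : ℕ)
    (hk0u : IsUnit ((k0 : ℕ) : ZMod (8 * r))) (hk1u : IsUnit ((k1 : ℕ) : ZMod (8 * r)))
    (hk2u : IsUnit ((k2 : ℕ) : ZMod (8 * r)))
    (hk0m : k0 % 8 = clsVal c0.1) (hk1m : k1 % 8 = clsVal c1.1) (hk2m : k2 % 8 = clsVal c2.1)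
    (hk0e : ∀ q : ℕ, q.Prime → q % (8 * r) = k0 % (8 * r) → (jacobiSym (q : ℤ) r = -1 ↔ c0.2 = true))
    (hk1e : ∀ q : ℕ, q.Prime → q % (8 * r) = k1 % (8 * r) → (jacobiSym (q : ℤ) r = -1 ↔ c1.2 = true))
    (hk2e : ∀ q : ℕ, q.Prime → q % (8 * r) = k2 % (8 * r) → (jacobiSym (q : ℤ) r = -1 ↔ c2.2 = true)) :
    ∃ C : ℝ, 0 < C ∧ ∀ Q : ℕ, 3 ≤ Q → ∃ E : Finset ℕ, (E.card : ℝ) ≤ C * Real.log Q ^ 8 ∧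
      ∀ p : ℕ, p.Prime → p % 8 = clsVal pc → (jacobiSym (r : ℤ) p = -1 ↔ rp = true) →
        Nat.sqrt Q < p → p ≤ Q → p ∉ E →
        ∃ (K : Type) (_ : Field K) (_ : NumberField K),
          IsImaginaryQuadratic K ∧ 4 < (NumberField.discr K).natAbs ∧
          SatisfiesHeegnerHypothesis ((congruentNumberCurve (2 * (p * r))).conductorNorm ℤ) K ∧
          ((congruentNumberCurve (2 * (p * r))).quadraticTwist (NumberField.discr K : ℚ)).entireLFunction 1 ≠ 0 ∧
          ¬ p ∣ NumberField.classNumber K := by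
  haveI : NeZero (8 * r) := ⟨Nat.mul_ne_zero (by norm_num) hr.ne_zero⟩
  have hσ0 : (if s0 then (-1 : ℤ) else 1) = 1 ∨ (if s0 then (-1 : ℤ) else 1) = -1 := by cases s0 <;> simp
  have hσ1 : (if s1 then (-1 : ℤ) else 1) = 1 ∨ (if s1 then (-1 : ℤ) else 1) = -1 := by cases s1 <;> simp
  have hσ2 : (if s2 then (-1 : ℤ) else 1) = 1 ∨ (if s2 then (-1 : ℤ) else 1) = -1 := by cases s2 <;> simp
  obtain ⟨C0, hC0, hcen0⟩ := slotCensus (8 * r) k0 hk0u hσ0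
  obtain ⟨C1, hC1, hcen1⟩ := slotCensus (8 * r) k1 hk1u hσ1
  obtain ⟨C2, hC2, hcen2⟩ := slotCensus (8 * r) k2 hk2u hσ2
  refine ⟨C0 + C1 + C2 + ((r : ℝ) ^ 2 + 256 ^ 4 + 1), by positivity, fun Q hQ3 => ?_⟩
  have hlog3 : 1 ≤ Real.log Q := by
    have hQ3' : (3 : ℝ) ≤ Q := by exact_mod_cast hQ3
    have he : Real.exp 1 ≤ (Q : ℝ) := le_trans (le_of_lt (lt_trans Real.exp_one_lt_d9 (by norm_num))) hQ3'
    rwa [← Real.log_le_log_iff (Real.exp_pos 1) (by linarith), Real.log_exp] at he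
  have hlog8 : 1 ≤ Real.log Q ^ 8 := one_le_pow₀ hlog3
  by_cases hQr : r ^ 2 + 256 ^ 4 ≤ Q
  · set E0 := (Finset.range (Q + 1)).filter (fun p : ℕ => p.Prime ∧ Nat.sqrt Q < p ∧
        ∀ q : ℕ, q.Prime → q % (8 * r) = k0 % (8 * r) → q ≤ Nat.sqrt (Nat.sqrt Q) →
          jacobiSym (q : ℤ) p ≠ (if s0 then (-1 : ℤ) else 1)) with hE0
    set E1 := (Finset.range (Q + 1)).filter (fun p : ℕ => p.Prime ∧ Nat.sqrt Q < p ∧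
        ∀ q : ℕ, q.Prime → q % (8 * r) = k1 % (8 * r) → q ≤ Nat.sqrt (Nat.sqrt Q) →
          jacobiSym (q : ℤ) p ≠ (if s1 then (-1 : ℤ) else 1)) with hE1
    set E2 := (Finset.range (Q + 1)).filter (fun p : ℕ => p.Prime ∧ Nat.sqrt Q < p ∧
        ∀ q : ℕ, q.Prime → q % (8 * r) = k2 % (8 * r) → q ≤ Nat.sqrt (Nat.sqrt Q) →
          jacobiSym (q : ℤ) p ≠ (if s2 then (-1 : ℤ) else 1)) with hE2
    refine ⟨E0 ∪ E1 ∪ E2, ?_, ?_⟩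
    · have hu : ((E0 ∪ E1 ∪ E2).card : ℝ) ≤ (E0.card : ℝ) + E1.card + E2.card := by
        have a := Finset.card_union_le (E0 ∪ E1) E2
        have b := Finset.card_union_le E0 E1
        exact_mod_cast a.trans (Nat.add_le_add_right b _)
      calc ((E0 ∪ E1 ∪ E2).card : ℝ) ≤ (E0.card : ℝ) + E1.card + E2.card := hu
        _ ≤ C0 * Real.log Q ^ 8 + C1 * Real.log Q ^ 8 + C2 * Real.log Q ^ 8 :=
            add_le_add (add_le_add (hcen0 Q hQ3) (hcen1 Q hQ3)) (hcen2 Q hQ3)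
        _ ≤ (C0 + C1 + C2 + ((r : ℝ) ^ 2 + 256 ^ 4 + 1)) * Real.log Q ^ 8 := by nlinarith
    intro p hp hpm hrp hyp hpQ hpE
    simp only [Finset.mem_union, not_or] at hpE
    obtain ⟨⟨hn0, hn1⟩, hn2⟩ := hpE
    obtain ⟨q0, hq0, hq0k, hq0y, hJ0⟩ := exists_slotPrime hp hyp hpQ hn0
    obtain ⟨q1, hq1, hq1k, hq1y, hJ1⟩ := exists_slotPrime hp hyp hpQ hn1
    obtain ⟨q2, hq2, hq2k, hq2y, hJ2⟩ := exists_slotPrime hp hyp hpQ hn2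
    obtain ⟨hq0m, hq0r⟩ := slot_props hr hk0u hq0k hk0m
    obtain ⟨hq1m, hq1r⟩ := slot_props hr hk1u hq1k hk1m
    obtain ⟨hq2m, hq2r⟩ := slot_props hr hk2u hq2k hk2m
    have he0 := hk0e q0 hq0 hq0k
    have he1 := hk1e q1 hq1 hq1k
    have he2 := hk2e q2 hq2 hq2k
    have hyQ : Nat.sqrt (Nat.sqrt Q) ≤ Nat.sqrt Q := Nat.sqrt_le_self _
    have hq0p : q0 ≠ p := by intro h; subst h; omega
    have hq1p : q1 ≠ p := by intro h; subst h; omega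
    have hq2p : q2 ≠ p := by intro h; subst h; omega
    have hrQ : r ≤ Nat.sqrt Q := Nat.le_sqrt'.mpr (le_trans (Nat.le_add_right _ _) hQr)
    have hpr : p ≠ r := by intro h; subst h; omega
    have hd01 : q0 ≠ q1 := ne_of_cells_ne h01 hq0m hq1m he0 he1
    have hd02 : q0 ≠ q2 := ne_of_cells_ne h02 hq0m hq2m he0 he2
    have hd12 : q1 ≠ q2 := ne_of_cells_ne h12 hq1m hq2m he1 he2
    have hysq : Nat.sqrt (Nat.sqrt Q) ^ 2 ≤ Nat.sqrt Q := Nat.sqrt_le' _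
    have hy256 : 256 ≤ Nat.sqrt (Nat.sqrt Q) := by
      rw [Nat.le_sqrt', Nat.le_sqrt']
      exact le_trans (by norm_num) (le_trans (Nat.le_add_left _ _) hQr)
    have hsize := size_three hq0.one_lt.le hq1.one_lt.le hq2.one_lt.le hq0y hq1y hq2y hy256 (lt_of_le_of_lt hysq hyp)
    exact Recipe.RealisesK1.cruxOnE2pr_of_patternFree_three_of_BT hBT c0 c1 c2 s0 s1 s2 hwin hp hr hq0 hq1 hq2 hpm hrm
      hq0m hq1m hq2m hpr hq0p hq1p hq2p hq0r hq1r hq2r hd01 hd02 hd12 hrp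
      (sign_iff_of_eq hJ0) (sign_iff_of_eq hJ1) (sign_iff_of_eq hJ2) he0 he1 he2 hsize
  · refine ⟨Finset.range (Q + 1), ?_, fun p _ _ _ _ hpQ hpE => absurd (Finset.mem_range.mpr (by omega)) hpE⟩
    have hQ' : Q < r ^ 2 + 256 ^ 4 := not_le.mp hQr
    have h1 : ((Finset.range (Q + 1)).card : ℝ) ≤ (r : ℝ) ^ 2 + 256 ^ 4 + 1 := by
      rw [Finset.card_range]; exact_mod_cast (by omega : Q + 1 ≤ r ^ 2 + 256 ^ 4 + 1)
    calc ((Finset.range (Q + 1)).card : ℝ) ≤ (r : ℝ) ^ 2 + 256 ^ 4 + 1 := h1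
      _ ≤ C0 + C1 + C2 + ((r : ℝ) ^ 2 + 256 ^ 4 + 1) := by linarith
      _ = (C0 + C1 + C2 + ((r : ℝ) ^ 2 + 256 ^ 4 + 1)) * 1 := (mul_one _).symm
      _ ≤ (C0 + C1 + C2 + ((r : ℝ) ^ 2 + 256 ^ 4 + 1)) * Real.log Q ^ 8 :=
          mul_le_mul_of_nonneg_left hlog8 (by positivity)

/-! ## Headline instance `W = E_{17p}`, `p ≡ 7 (mod 8)` -/

/-- `(q/17)` from `q mod 136`. [folklore] -/
theorem jacobiSym_seventeen_of_mod {q k : ℕ} (hq : q % 136 = k % 136) :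
    jacobiSym (q : ℤ) 17 = jacobiSym ((k % 17 : ℕ) : ℤ) 17 := by
  rw [jacobiSym.mod_left (q : ℤ) 17, jacobiSym.mod_left ((k % 17 : ℕ) : ℤ) 17]
  congr 1
  have h : q % 17 = k % 17 := by
    rw [← Nat.mod_mod_of_dvd q (by norm_num : 17 ∣ 136), hq, Nat.mod_mod_of_dvd k (by norm_num : 17 ∣ 136)]
  omega

open scoped Classical in
/-- ★ **`E_{17p}`: the conclusion of crux 21381 for all but `O(log⁸ Q)` primes `p ≡ 7 (mod 8)`, modulo Burungale–Tian** — the first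
instance needing a THREE-slot family: `(17/p) = +1` by cells `(1,(·/17)=−1)`, `(3,+1)`, `(5,−1)`, signs `+1,+1,−1`, slots `41, 35, 5 (mod 136)`
(wins for all eight mutual patterns); `(17/p) = −1` by the two-slot family `(3,+1)`, `(5,+1)`, signs `+1,−1`, slots `35, 13 (mod 136)`.
[cite: BurungaleTian2026, Thm. 1.1] [cite: Montgomery1978, p. 561] [cite: MontgomeryVaughan2007, Cor. 11.17] -/
theorem cruxConclusion_E17p_allBut_of_BT (hBT : burungaleTian_analyticRank_eq_zero_of_selmerCorank_eq_zero_of_hasCM) :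
    ∃ C : ℝ, 0 < C ∧ ∀ Q : ℕ, 3 ≤ Q → ∃ E : Finset ℕ, (E.card : ℝ) ≤ C * Real.log Q ^ 8 ∧
      ∀ p : ℕ, p.Prime → p % 8 = 7 → Nat.sqrt Q < p → p ≤ Q → p ∉ E →
        ∃ (K : Type) (_ : Field K) (_ : NumberField K),
          IsImaginaryQuadratic K ∧ 4 < (NumberField.discr K).natAbs ∧
          SatisfiesHeegnerHypothesis ((congruentNumberCurve (17 * p)).conductorNorm ℤ) K ∧
          ((congruentNumberCurve (17 * p)).quadraticTwist (NumberField.discr K : ℚ)).entireLFunction 1 ≠ 0 ∧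
          ¬ p ∣ NumberField.classNumber K := by
  have h17 : Nat.Prime 17 := by norm_num
  -- `(17/p) = +1`: three slots
  obtain ⟨Cf, hCf, hf⟩ := kOne_allBut_three_of_BT hBT (pc := 3) (rc := 0) (rp := false) (0, true) (1, false) (2, true)
    false false true (by decide) (by decide) (by decide) (by decide) h17 (by decide) 41 35 5
    ((ZMod.isUnit_iff_coprime 41 (8 * 17)).mpr (by norm_num)) ((ZMod.isUnit_iff_coprime 35 (8 * 17)).mpr (by norm_num))
    ((ZMod.isUnit_iff_coprime 5 (8 * 17)).mpr (by norm_num))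
    (by decide) (by decide) (by decide)
    (fun q _ hq => by rw [jacobiSym_seventeen_of_mod hq]; norm_num)
    (fun q _ hq => by rw [jacobiSym_seventeen_of_mod hq]; norm_num)
    (fun q _ hq => by rw [jacobiSym_seventeen_of_mod hq]; norm_num)
  -- `(17/p) = −1`: two slots
  obtain ⟨Ct, hCt, ht⟩ := kOne_allBut_two_of_BT hBT (pc := 3) (rc := 0) (rp := true) (1, false) (2, false) false true
    (by decide) (by decide) h17 (by decide) 35 13
    ((ZMod.isUnit_iff_coprime 35 (8 * 17)).mpr (by norm_num)) ((ZMod.isUnit_iff_coprime 13 (8 * 17)).mpr (by norm_num))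
    (by decide) (by decide)
    (fun q _ hq => by rw [jacobiSym_seventeen_of_mod hq]; norm_num)
    (fun q _ hq => by rw [jacobiSym_seventeen_of_mod hq]; norm_num)
  refine ⟨Cf + Ct, by positivity, fun Q hQ => ?_⟩
  obtain ⟨Ef, hEf, hpf⟩ := hf Q hQ
  obtain ⟨Et, hEt, hpt⟩ := ht Q hQ
  refine ⟨Ef ∪ Et, ?_, ?_⟩
  · calc ((Ef ∪ Et).card : ℝ) ≤ (Ef.card : ℝ) + Et.card := by exact_mod_cast Finset.card_union_le Ef Et
      _ ≤ Cf * Real.log Q ^ 8 + Ct * Real.log Q ^ 8 := add_le_add hEf hEt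
      _ = (Cf + Ct) * Real.log Q ^ 8 := by ring
  intro p hp hp8 hyp hpQ hpE
  rw [Finset.mem_union, not_or] at hpE
  rw [show 17 * p = p * 17 from Nat.mul_comm 17 p]
  have hp17 : (17 : ℕ) ≠ p := by rintro rfl; omega
  have hcop : Int.gcd ((17 : ℕ) : ℤ) p = 1 := by
    rw [Int.gcd_natCast_natCast]; exact (Nat.coprime_primes h17 hp).mpr hp17
  rcases jacobiSym.eq_one_or_neg_one hcop with h | h
  · exact hpf p hp (by simpa [clsVal] using hp8) (by rw [h]; simp) hyp hpQ hpE.1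
  · exact hpt p hp (by simpa [clsVal] using hp8) (by rw [h]; simp) hyp hpQ hpE.2

end Summit.BirchSwinnertonDyer.BirchSwinnertonDyer.Theorems.LinnikCensus
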